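import Summits.ResolutionOfSingularities.ResolutionOfSingularities.Theorems.HilbertSamuelEliminationSigmaMaxModificationsCorridor3SigmaMenuDefs
import HarnessLib

/-!
# [OURS · L1 W4.2] σ-LAYER (E2′) — `Corridor3SigmaMenuPlus`: the WIDER intrinsic menu of RULINGS v3.14-11c (CT)'s gloss

Additive sibling of `…Corridor3SigmaMenuDefs` (res-type-067 g12, same object «INTRINSIC MENU + CORNER LOCUS», RULINGS v3.14-11c (CS)/(CT), (CU),
v3.14-12 (BR-6)). OURS (cell res-hironaka, slot W4.2); NOT statements of H. Hironaka's manuscript [Hironaka2017] nor of [CossartJannsenSaito2020];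
AI-typed, weaker than expert review. Helper VOCABULARY `--supports stmt-ResolutionOfSingularities-19249 --as helper` (counted 0); NO row is claimed.

RULINGS (CS)'s formal definition (`IntrinsicMenuAt`, the menu OF RECORD) lists: the point, and the irreducible components through `x` of
`X(ν) ∩ ⋂_{I ∈ K} V(I)` for sub-families `K` of the boundary members through `x`. RULINGS (CT)'s gloss also lists «THEIR INTERSECTIONS» — the
intersections of several stratum components through `x` (torically `D_{J₁} ∩ D_{J₂} = D_{J₁ ∪ J₂}` for two minimal legal `J`'s is intrinsic although
`J₁ ∪ J₂` uses no boundary index). `IntrinsicMenuPlusAt` below also cuts by any sub-family `𝒮` of the components of `X(ν)` through `x`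
(`𝒮 = ∅` ⇒ the menu of record: `intrinsicMenuAt_subset_plus`). It is finite on a noetherian stage and its regular members are permissible by the same
tree lemma. Which name the scheme-side ω_ρ / idea-2's restricted rank reads is the planner's choice.
-/

noncomputable section

set_option linter.dupNamespace false

open CategoryTheory AlgebraicGeometry TopologicalSpace
open Summit.ResolutionOfSingularities.ResolutionOfSingularities.Theorems.CampaignW42
open Literature.AlgebraicGeometry.Resolution Literature.RingTheory.HilbertSamuel
open Summit.ResolutionOfSingularities.ResolutionOfSingularities.Theorems.SigmaMaxModificationsCorridor3.Helpers
  (isPermissible_of_isRegular_subscheme_of_support_subset_hsStratum_of_isExcellent)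

namespace Summit.ResolutionOfSingularities.ResolutionOfSingularities.Theorems.SigmaMaxModificationsCorridor3.Sigma

universe u

variable {W : Scheme.{u}}

/-! ## The WIDER intrinsic menu of RULINGS (CT)'s gloss («components of X(ν) through x; THEIR INTERSECTIONS; S ∩ E_k»): §1's menu
(RULINGS (CS) verbatim, OF RECORD) omits the intersections of several stratum components through `x` (torically `D_{J₁} ∩ D_{J₂} = D_{J₁ ∪ J₂}`
is intrinsic although `J₁ ∪ J₂` uses no boundary index); the wider menu also cuts by any sub-family `𝒮` of those components (`𝒮 = ∅` ⇒ §1's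
menu). Both are finite and both feed §2; which name ω_ρ reads is the planner's choice. -/

/-- [OURS · L1 W4.2] **THE WIDER INTRINSIC MENU AT `x`** ((CT)'s gloss): `closure {x}` and, for every sub-family `𝒮` of the irreducible components of
`X(ν)` through `x` and every sub-family `K` of the boundary members through `x`, the irreducible components through `x` of
`(⋂_{S ∈ 𝒮} S) ∩ X(ν) ∩ ⋂_{I ∈ K} V(I)`. NOT a statement of the manuscript. [folklore] -/
def IntrinsicMenuPlusAt (E : Boundary W) (N : ℕ) (ν : ℕ → ℕ) (x : W) : Set (Set W) :=
  {closure {x}} ∪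
    {Z | ∃ 𝒮 : Set (Set W), 𝒮 ⊆ {S | S ∈ componentsIn (Scheme.hsStratum W N ν) ∧ x ∈ S} ∧
      ∃ K ∈ (membersThrough E x).sublists,
        Z ∈ componentsIn {y | (∀ S ∈ 𝒮, y ∈ S) ∧ y ∈ boundaryStratum W N ν K} ∧ x ∈ Z}

/-- §1's menu is contained in the wider one (`𝒮 = ∅`). [folklore] -/
theorem intrinsicMenuAt_subset_plus (E : Boundary W) (N : ℕ) (ν : ℕ → ℕ) (x : W) :
    IntrinsicMenuAt E N ν x ⊆ IntrinsicMenuPlusAt E N ν x := by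
  rintro Z (h | ⟨K, hK, hZ, hx⟩)
  · exact Or.inl h
  · refine Or.inr ⟨∅, Set.empty_subset _, K, hK, ?_, hx⟩
    have : {y : W | (∀ S ∈ (∅ : Set (Set W)), y ∈ S) ∧ y ∈ boundaryStratum W N ν K} = boundaryStratum W N ν K := by
      ext y; simp
    rw [this]; exact hZ

/-- Every member of the wider menu contains the point. [folklore] -/
theorem mem_of_mem_intrinsicMenuPlusAt {E : Boundary W} {N : ℕ} {ν : ℕ → ℕ} {x : W} {Z : Set W}
    (hZ : Z ∈ IntrinsicMenuPlusAt E N ν x) : x ∈ Z := by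
  rcases hZ with h | ⟨_, _, _, _, _, hx⟩
  · rw [Set.mem_singleton_iff.mp h]; exact subset_closure rfl
  · exact hx

/-- Every member of the wider menu lies in the `ν`-stratum (`x ∈ X(ν)`, `X(ν)` closed). [folklore] -/
theorem subset_hsStratum_of_mem_intrinsicMenuPlusAt {E : Boundary W} {N : ℕ} {ν : ℕ → ℕ} {x : W} {Z : Set W}
    (hY : IsClosed (Scheme.hsStratum W N ν)) (hx : x ∈ Scheme.hsStratum W N ν) (hZ : Z ∈ IntrinsicMenuPlusAt E N ν x) :
    Z ⊆ Scheme.hsStratum W N ν := by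
  rcases hZ with h | ⟨𝒮, -, K, -, hZK, -⟩
  · rw [Set.mem_singleton_iff.mp h]
    exact hY.closure_subset_iff.mpr (Set.singleton_subset_iff.mpr hx)
  · exact (componentsIn.subset hZK).trans fun y hy => boundaryStratum_subset_hsStratum N ν K hy.2

/-- Every member of the wider menu is closed (`X(ν)` closed). [folklore] -/
theorem isClosed_of_mem_intrinsicMenuPlusAt {E : Boundary W} {N : ℕ} {ν : ℕ → ℕ} {x : W} {Z : Set W}
    (hY : IsClosed (Scheme.hsStratum W N ν)) (hZ : Z ∈ IntrinsicMenuPlusAt E N ν x) : IsClosed Z := by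
  rcases hZ with h | ⟨𝒮, h𝒮, K, -, hZK, -⟩
  · rw [Set.mem_singleton_iff.mp h]; exact isClosed_closure
  · refine componentsIn.isClosed ?_ hZK
    have hS : ∀ S ∈ 𝒮, IsClosed S := fun S hS => componentsIn.isClosed hY (h𝒮 hS).1
    have : {y : W | (∀ S ∈ 𝒮, y ∈ S) ∧ y ∈ boundaryStratum W N ν K} = (⋂ S ∈ 𝒮, S) ∩ boundaryStratum W N ν K := by
      ext y; simp [Set.mem_iInter]
    rw [this]
    exact (isClosed_biInter hS).inter (isClosed_boundaryStratum hY K)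

/-- **THE WIDER MENU IS FINITE** on a noetherian stage: finitely many sub-families of the (finitely many) components through `x`, finitely many
sub-families of the members through `x`, finitely many components each time. [folklore] -/
theorem intrinsicMenuPlusAt_finite [NoetherianSpace W] (E : Boundary W) (N : ℕ) (ν : ℕ → ℕ) (x : W) :
    (IntrinsicMenuPlusAt E N ν x).Finite := by
  refine (Set.finite_singleton _).union ?_
  have hC : {S : Set W | S ∈ componentsIn (Scheme.hsStratum W N ν) ∧ x ∈ S}.Finite :=
    (componentsIn.finite _).subset fun S hS => hS.1
  have hfin : (⋃ 𝒮 ∈ {𝒮 : Set (Set W) | 𝒮 ⊆ {S | S ∈ componentsIn (Scheme.hsStratum W N ν) ∧ x ∈ S}},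
      ⋃ K ∈ (membersThrough E x).sublists,
        componentsIn {y : W | (∀ S ∈ 𝒮, y ∈ S) ∧ y ∈ boundaryStratum W N ν K}).Finite :=
    Set.Finite.biUnion hC.finite_subsets fun 𝒮 _ =>
      Set.Finite.biUnion (List.finite_toSet _) fun K _ => componentsIn.finite _
  refine hfin.subset ?_
  rintro Z ⟨𝒮, h𝒮, K, hK, hZ, -⟩
  exact Set.mem_biUnion h𝒮 (Set.mem_biUnion hK hZ)

/-- **A REGULAR member of the WIDER menu is `ν`-permissible** (same lemma, by name). [cite: CossartJannsenSaito2020, Def. 3.1 (2), Thm. 3.3] -/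
theorem isPermissible_menuCentre_of_mem_plus [IsLocallyNoetherian W] [IsReduced W] (hexc : Scheme.IsExcellent W) {N : ℕ}
    (hdim : topologicalKrullDim W ≤ (N : WithBot ℕ∞)) {ν : ℕ → ℕ} (hν : ν ≠ iterPSum N Phi)
    {E : Boundary W} {x : W} (hY : IsClosed (Scheme.hsStratum W N ν)) (hx : x ∈ Scheme.hsStratum W N ν)
    {Z : Closeds W} (hZ : (Z : Set W) ∈ IntrinsicMenuPlusAt E N ν x) (hreg : Scheme.IsRegular (menuCentre Z).subscheme) :
    IdealSheafData.IsPermissible (menuCentre Z) :=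
  isPermissible_of_isRegular_subscheme_of_support_subset_hsStratum_of_isExcellent hexc hdim hν (menuCentre Z) hreg
    (by rw [coe_support_menuCentre]; exact subset_hsStratum_of_mem_intrinsicMenuPlusAt hY hx hZ)

/-! ## (appended 2026-08-27, same seat, rev 2) `IsMenuCentrePlusAt` — the centre predicate on the WIDER menu (RULING v3.14-13 (DB): «menu OF
RECORD FOR THE ORACLE ω_ρ»; res-L1-type-o1's `…SigmaMenuStrategyPlus` keys on these names) -/

/-- [OURS · L1 W4.2] **`C` IS A MENU CENTRE AT `x` FOR THE WIDER MENU**: `C` is the reduced structure on a member of `IntrinsicMenuPlusAt E N ν x`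
AND its subscheme is REGULAR (regularity = a hypothesis in the datum, tri-1 V8-d). The oracle's centre type per RULING v3.14-13 (DA)/(DB).
NOT a statement of the manuscript. [folklore] -/
def IsMenuCentrePlusAt (E : Boundary W) (N : ℕ) (ν : ℕ → ℕ) (x : W) (C : W.IdealSheafData) : Prop :=
  (∃ Z : Closeds W, (Z : Set W) ∈ IntrinsicMenuPlusAt E N ν x ∧ C = menuCentre Z) ∧ Scheme.IsRegular C.subscheme

/-- A menu centre of record (§1 menu) is a menu centre for the wider menu. [folklore] -/
theorem IsMenuCentreAt.plus {E : Boundary W} {N : ℕ} {ν : ℕ → ℕ} {x : W} {C : W.IdealSheafData}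
    (h : IsMenuCentreAt E N ν x C) : IsMenuCentrePlusAt E N ν x C := by
  obtain ⟨⟨Z, hZ, rfl⟩, hreg⟩ := h
  exact ⟨⟨Z, intrinsicMenuAt_subset_plus E N ν x hZ, rfl⟩, hreg⟩

/-- A wider-menu centre has its support on the wider menu. [folklore] -/
theorem IsMenuCentrePlusAt.support_mem {E : Boundary W} {N : ℕ} {ν : ℕ → ℕ} {x : W} {C : W.IdealSheafData}
    (h : IsMenuCentrePlusAt E N ν x C) : (C.support : Set W) ∈ IntrinsicMenuPlusAt E N ν x := by
  obtain ⟨⟨Z, hZ, rfl⟩, -⟩ := h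
  simpa using hZ

/-- A wider-menu centre passes through the marked point. [folklore] -/
theorem IsMenuCentrePlusAt.mem_support {E : Boundary W} {N : ℕ} {ν : ℕ → ℕ} {x : W} {C : W.IdealSheafData}
    (h : IsMenuCentrePlusAt E N ν x C) : x ∈ (C.support : Set W) :=
  mem_of_mem_intrinsicMenuPlusAt h.support_mem

/-- A wider-menu centre lies in the `ν`-stratum (`x ∈ X(ν)`, `X(ν)` closed). [folklore] -/
theorem IsMenuCentrePlusAt.support_subset_hsStratum {E : Boundary W} {N : ℕ} {ν : ℕ → ℕ} {x : W} {C : W.IdealSheafData}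
    (h : IsMenuCentrePlusAt E N ν x C) (hY : IsClosed (Scheme.hsStratum W N ν)) (hx : x ∈ Scheme.hsStratum W N ν) :
    (C.support : Set W) ⊆ Scheme.hsStratum W N ν :=
  subset_hsStratum_of_mem_intrinsicMenuPlusAt hY hx h.support_mem

/-- A wider-menu centre is regular (by its type). [folklore] -/
theorem IsMenuCentrePlusAt.isRegular {E : Boundary W} {N : ℕ} {ν : ℕ → ℕ} {x : W} {C : W.IdealSheafData}
    (h : IsMenuCentrePlusAt E N ν x C) : Scheme.IsRegular C.subscheme :=
  h.2

/-- **A wider-menu centre is `ν`-permissible** (BY NAME, same tree lemma). [cite: CossartJannsenSaito2020, Def. 3.1 (2), Thm. 3.3] -/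
theorem IsMenuCentrePlusAt.isPermissible [IsLocallyNoetherian W] [IsReduced W] (hexc : Scheme.IsExcellent W) {N : ℕ}
    (hdim : topologicalKrullDim W ≤ (N : WithBot ℕ∞)) {ν : ℕ → ℕ} (hν : ν ≠ iterPSum N Phi)
    {E : Boundary W} {x : W} (hY : IsClosed (Scheme.hsStratum W N ν)) (hx : x ∈ Scheme.hsStratum W N ν)
    {C : W.IdealSheafData} (h : IsMenuCentrePlusAt E N ν x C) : IdealSheafData.IsPermissible C := by
  obtain ⟨⟨Z, hZ, rfl⟩, hreg⟩ := h
  exact isPermissible_menuCentre_of_mem_plus hexc hdim hν hY hx hZ hreg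

/-- **THE ADMISSIBILITY CLAUSE for a wider-menu centre** (clause (a) of `IsAdmissibleStrategyOnE`; the slot of o1's `MenuClauseA`): permissible,
inside the `ν`-stratum, non-empty. [cite: CossartJannsenSaito2020, Def. 3.1, Rem. 6.29 (1)] -/
theorem IsMenuCentrePlusAt.admissibleClause [IsLocallyNoetherian W] [IsReduced W] (hexc : Scheme.IsExcellent W) {N : ℕ}
    (hdim : topologicalKrullDim W ≤ (N : WithBot ℕ∞)) {ν : ℕ → ℕ} (hν : ν ≠ iterPSum N Phi)
    {E : Boundary W} {x : W} (hY : IsClosed (Scheme.hsStratum W N ν)) (hx : x ∈ Scheme.hsStratum W N ν)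
    {C : W.IdealSheafData} (h : IsMenuCentrePlusAt E N ν x C) :
    IdealSheafData.IsPermissible C ∧ (C.support : Set W) ⊆ Scheme.hsStratum W N ν ∧
      ((Scheme.hsStratum W N ν).Nonempty → (C.support : Set W).Nonempty) :=
  ⟨h.isPermissible hexc hdim hν hY hx, h.support_subset_hsStratum hY hx, fun _ => ⟨x, h.mem_support⟩⟩

/-- The point centre is a wider-menu centre whenever it is regular as a reduced subscheme. [folklore] -/
theorem isMenuCentrePlusAt_point {E : Boundary W} {N : ℕ} {ν : ℕ → ℕ} {x : W}
    (hreg : Scheme.IsRegular (menuCentre ⟨closure {x}, isClosed_closure⟩ : W.IdealSheafData).subscheme) :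
    IsMenuCentrePlusAt E N ν x (menuCentre ⟨closure {x}, isClosed_closure⟩) :=
  (isMenuCentreAt_point hreg).plus

/-- A stratum component through `x`, with its reduced structure regular, is a wider-menu centre (`𝒮 = ∅`, `K = []`). [folklore] -/
theorem isMenuCentrePlusAt_of_mem_componentsIn_hsStratum {E : Boundary W} {N : ℕ} {ν : ℕ → ℕ} {x : W} {Z : Closeds W}
    (hZ : (Z : Set W) ∈ componentsIn (Scheme.hsStratum W N ν)) (hx : x ∈ (Z : Set W))
    (hreg : Scheme.IsRegular (menuCentre Z).subscheme) : IsMenuCentrePlusAt E N ν x (menuCentre Z) :=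
  ⟨⟨Z, intrinsicMenuAt_subset_plus E N ν x (mem_intrinsicMenuAt_of_mem_componentsIn_hsStratum hZ hx), rfl⟩, hreg⟩

end Summit.ResolutionOfSingularities.ResolutionOfSingularities.Theorems.SigmaMaxModificationsCorridor3.Sigma

end
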